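import Summits.Ventures.HodgeRepro2.T7SupportTwoTorusInvariant

/-!
# The double-coset invariant `κ`, matrix form (support, seat p1)

Companion of `T7SupportTwoTorusInvariant`: with `P = [f 0 | f 1]` the matrix of the second orthogonal basis,
`t' = P · diagonal b · P⁻¹` is the element of the second torus with eigenvalues `b` (`actsOn_conj_diagonal`), two
matrices agreeing on the basis are equal (`eq_of_mulVec_basis`), so the separation theorem reads
`γ' = diagonal a * γ * t'` with `t' ∈ T_B` (`exists_double_coset_matrix_of_kappa_eq`); and `P` is invertible as
soon as `f 0 ⊥ f 1` are non-isotropic (`isUnit_det_of_orth`).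

Pure algebra over a field with an involution; nothing here is about any adelic group, any automorphic
representation, or any period. Blind lane: Mathlib + the HodgeRepro2 prefix only; no sorry; axioms ⊆ {propext,
Classical.choice, Quot.sound}.
-/

namespace Summit.Ventures.HodgeRepro2.T7SupportTwoTorusMatrix

open Matrix T7SupportTwoTorusInvariant

variable {E : Type*} [Field E] (σ : E →+* E)

/-! ## 5. The matrix form: `γ' = diagonal a * γ * t'` with `t' ∈ T_B` -/

/-- the matrix `P = [f 0 | f 1]` of the second basis -/
def basisMat (f : Fin 2 → Fin 2 → E) : Matrix (Fin 2) (Fin 2) E := Matrix.of fun i j => f j i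

/-- `P e_j = f j`: the columns of `P` are the second basis -/
theorem basisMat_mulVec_single (f : Fin 2 → Fin 2 → E) (j : Fin 2) :
    basisMat f *ᵥ Pi.single j (1 : E) = f j := by
  rw [Matrix.mulVec_single]
  funext i
  simp [basisMat, Matrix.col]

/-- `P · diagonal b · P⁻¹` acts on the second basis by `b` -/
theorem actsOn_conj_diagonal (f : Fin 2 → Fin 2 → E) (hP : IsUnit (basisMat f).det) (b : Fin 2 → E) :
    ActsOn f (basisMat f * diagonal b * (basisMat f)⁻¹) b := by
  intro j
  have hPinv : (basisMat f)⁻¹ *ᵥ f j = Pi.single j (1 : E) := by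
    rw [← basisMat_mulVec_single f j, Matrix.mulVec_mulVec, Matrix.nonsing_inv_mul _ hP,
      Matrix.one_mulVec]
  rw [← Matrix.mulVec_mulVec, ← Matrix.mulVec_mulVec, hPinv, Matrix.diagonal_mulVec_single, mul_one,
    ← basisMat_mulVec_single f j, ← Matrix.mulVec_smul]
  congr 1
  funext i
  simp [Pi.single_apply]

/-- two matrices agreeing on the second basis are equal -/
theorem eq_of_mulVec_basis (f : Fin 2 → Fin 2 → E) (hP : IsUnit (basisMat f).det)
    (M N : Matrix (Fin 2) (Fin 2) E) (h : ∀ j, M *ᵥ f j = N *ᵥ f j) : M = N := by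
  have hMP : M * basisMat f = N * basisMat f := by
    ext i j
    have := congrFun (h j) i
    simp only [Matrix.mulVec, dotProduct] at this
    simp only [Matrix.mul_apply, basisMat, Matrix.of_apply]
    exact this
  calc M = M * basisMat f * (basisMat f)⁻¹ := by
        rw [Matrix.mul_assoc, Matrix.mul_nonsing_inv _ hP, Matrix.mul_one]
    _ = N * basisMat f * (basisMat f)⁻¹ := by rw [hMP]
    _ = N := by rw [Matrix.mul_assoc, Matrix.mul_nonsing_inv _ hP, Matrix.mul_one]

/-- **the double coset as a matrix identity**: `γ' = diagonal a * γ * t'` with `t' = P · diagonal b · P⁻¹`. -/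
theorem exists_double_coset_matrix_of_kappa_eq (hσ : ∀ x, σ (σ x) = x) (d : Fin 2 → E)
    (hd : ∀ i, σ (d i) = d i) (hd0 : ∀ i, d i ≠ 0) (f : Fin 2 → Fin 2 → E)
    (hP : IsUnit (basisMat f).det)
    (hf : herm σ d (f 0) (f 1) = 0) (hf0 : disc' σ d f 0 ≠ 0) (hf1 : disc' σ d f 1 ≠ 0)
    (γ γ' : Matrix (Fin 2) (Fin 2) E) (hγ : IsIsom σ d γ) (hγ' : IsIsom σ d γ')
    (hκ : kappa σ d f γ' = kappa σ d f γ) (hκ0 : kappa σ d f γ ≠ 0) (hκ1 : kappa σ d f γ ≠ 1) :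
    ∃ (a b : Fin 2 → E) (t' : Matrix (Fin 2) (Fin 2) E), (∀ i, nrm σ (a i) = 1) ∧
      (∀ j, nrm σ (b j) = 1) ∧ ActsOn f t' b ∧ γ' = diagonal a * γ * t' := by
  obtain ⟨a, b, ha, hb, h⟩ :=
    exists_double_coset_of_kappa_eq σ hσ d hd hd0 f hf hf0 hf1 γ γ' hγ hγ' hκ hκ0 hκ1
  refine ⟨a, b, basisMat f * diagonal b * (basisMat f)⁻¹, ha, hb, actsOn_conj_diagonal f hP b, ?_⟩
  apply eq_of_mulVec_basis f hP
  intro j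
  rw [h j]
  conv_rhs => rw [← Matrix.mulVec_mulVec, actsOn_conj_diagonal f hP b j]

/-- the determinant of `[f 0 | f 1]` is a unit when `f 0 ⊥ f 1` are non-isotropic -/
theorem isUnit_det_of_orth (hσ : ∀ x, σ (σ x) = x) (d : Fin 2 → E) (f : Fin 2 → Fin 2 → E)
    (hf : herm σ d (f 0) (f 1) = 0) (hf0 : disc' σ d f 0 ≠ 0) (hf1 : disc' σ d f 1 ≠ 0) :
    IsUnit (basisMat f).det := by
  rw [isUnit_iff_ne_zero]
  intro hdet
  rw [Matrix.det_fin_two] at hdet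
  simp only [basisMat, Matrix.of_apply] at hdet
  -- `f 0 0 * f 1 1 = f 1 0 * f 0 1`
  unfold disc' at hf0 hf1
  rw [herm_eq] at hf hf0 hf1
  by_cases h00 : f 0 0 = 0
  · have hprod : f 1 0 * f 0 1 = 0 := by
      rw [h00] at hdet
      linear_combination -hdet
    rcases mul_eq_zero.1 hprod with h10 | h01
    · rw [h00, h10] at hf
      rw [h00] at hf0
      rw [h10] at hf1
      simp only [map_zero, mul_zero, zero_add] at hf hf0 hf1
      rcases mul_eq_zero.1 hf with h | h
      · rw [h, zero_mul] at hf0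
        exact hf0 rfl
      · rcases mul_eq_zero.1 h with h | h
        · rw [h, zero_mul, mul_zero] at hf0
          exact hf0 rfl
        · have : f 1 1 = 0 := by rw [← hσ (f 1 1), h, map_zero]
          rw [this] at hf1
          simp at hf1
    · rw [h00, h01] at hf0
      simp at hf0
  · -- `f 1 = λ f 0` with `λ = f 1 0 / f 0 0`
    set lam : E := f 1 0 / f 0 0 with hlam
    have h10 : f 1 0 = lam * f 0 0 := by rw [hlam]; field_simp
    have h11 : f 1 1 = lam * f 0 1 := by
      rw [hlam]
      field_simp
      linear_combination hdet
    rw [h10, h11] at hf hf1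
    simp only [map_mul] at hf hf1
    have hf' : σ lam * (d 0 * (f 0 0 * σ (f 0 0)) + d 1 * (f 0 1 * σ (f 0 1))) = 0 := by
      linear_combination hf
    rcases mul_eq_zero.1 hf' with h | h
    · have hl : lam = 0 := by rw [← hσ lam, h, map_zero]
      rw [hl] at hf1
      simp at hf1
    · exact hf0 h

end Summit.Ventures.HodgeRepro2.T7SupportTwoTorusMatrix
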